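import Mathlib
import Summits.QuantumAdvantage.QuantumAdvantage.Theses.MobiusLadder
import Summits.QuantumAdvantage.QuantumAdvantage.Theorems.MobiusLadderQuadraticDigitPhasesStubWordDecayOfUWC
import Summits.QuantumAdvantage.QuantumAdvantage.Theorems.MobiusLadderQuadraticDigitPhasesStubStationary
import Summits.QuantumAdvantage.QuantumAdvantage.Theorems.MobiusLadderQuadraticDigitPhasesStubUwcOfNoExact
import Summits.QuantumAdvantage.QuantumAdvantage.Theorems.MobiusLadderQuadraticDigitPhasesStubNoExactTwistedCycle
import Summits.QuantumAdvantage.QuantumAdvantage.Theorems.MobiusLadderQuadraticDigitPhasesReduction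
import Summits.QuantumAdvantage.QuantumAdvantage.Theorems.MobiusLadderQuadraticDigitPhasesStubStructureA
import Summits.QuantumAdvantage.QuantumAdvantage.Theorems.MobiusLadderQuadraticDigitPhasesStubBlockSum
import Summits.QuantumAdvantage.QuantumAdvantage.Theorems.MobiusLadderQuadraticDigitPhasesStubLowCutKataiAsm
import Summits.QuantumAdvantage.QuantumAdvantage.Theorems.MobiusLadderQuadraticDigitPhasesStubOpSem
import Summits.QuantumAdvantage.QuantumAdvantage.Theorems.MobiusLadderQuadraticDigitPhasesStubLossCount
import Summits.QuantumAdvantage.QuantumAdvantage.Theorems.MobiusLadderQuadraticDigitPhasesStubRankLe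
import Summits.QuantumAdvantage.QuantumAdvantage.Theorems.MobiusLadderQuadraticDigitPhasesStubRankSplit
import Summits.QuantumAdvantage.QuantumAdvantage.Theorems.MobiusLadderQuadraticDigitPhasesStubRankTrunc
import Summits.QuantumAdvantage.QuantumAdvantage.Theorems.MobiusLadderQuadraticDigitPhasesStubRankAsm
import Summits.QuantumAdvantage.QuantumAdvantage.Theorems.MobiusLadderQuadraticDigitPhasesStubDickson
import Summits.QuantumAdvantage.QuantumAdvantage.Theorems.MobiusLadderQuadraticDigitPhasesStubFlipPhase
import Summits.QuantumAdvantage.QuantumAdvantage.Theorems.MobiusLadderQuadraticDigitPhasesStubFlipGood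
import Summits.QuantumAdvantage.QuantumAdvantage.Theorems.MobiusLadderQuadraticDigitPhasesStubUwcOpCoreFalse
import Summits.QuantumAdvantage.QuantumAdvantage.Theorems.MobiusLadderQuadraticDigitPhasesStubOrbitGauss
import Summits.QuantumAdvantage.QuantumAdvantage.Theorems.MobiusLadderQuadraticDigitPhasesStubLabelFourier
import Summits.QuantumAdvantage.QuantumAdvantage.Theorems.MobiusLadderQuadraticDigitPhasesStubEchelonCombos

/-!
# Skeleton of line `Sketch` for the crux `MobiusLadder.QuadraticDigitPhases` (stmt-QuantumAdvantage-1391)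

Lead skeleton v41 (continuation lead `prover-line-stmt-QuantumAdvantage-1391-c5-0`).  The crux is
`QuadraticDigitPhases_of` at the bottom; `sorry` occurs only in `stub_*` declarations.

State of the line (v30: see the docstrings of `stub_uwcOpCoreFalse` and `stub_rankCore` — the v22–v29 core was refuted by the lead c5 and the LOW branch re-decomposed along the RANK invariant).  Everything except the LOW-cut Kátai decay `lowCutKatai` is LANDED (word decay for all pairs of distinct
odd primes p117124 p117813 p117599 p121131; reduction p116207; the nine orbit-method inputs p124303 … p125735 stay in the
tree as supports).  Lead c4 RESHAPED the single open stub of v20 (`stub_lowCutKatai_of`, orbit method + "structure B")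
after showing that the flip/orbit method cannot close it alone (the sparse `e₂` family `Σ_{i<j} x_{b_i}x_{b_j}` has cut rank 1,
is not `(R,s)`-low, and every flip derivative is constant on the pinned class or changes the end state, so no independent
family of size ≥ 2 exists; it decays at rate `(1+γ)/2` by a fibre-walk mechanism instead).  The new decomposition is the
transfer-operator one:

* `stub_blockSum` (SEMANTICS, LANDED p131890): on an aligned dyadic block of level `N` the Kátai product phase factors through the
  reduced carry-automaton state `(⌊pT/2^N⌋, ⌊qT/2^N⌋, pending forms)`; hence the block sum is bounded by the `ℓ¹` norm of
  the signed state measure `Σ_state |Σ_{T ∈ state} (−1)^{Φ_N(T)}|`.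
* `uwcW` ("inhomogeneous width-`w` uniform word contraction"): for distinct odd primes `p, q`, cut rank `< R₀` everywhere and
  `g(p,q,R₀,δ)` sequential far pairs of span `> s(p,q,R₀,δ)` below `N` force that `ℓ¹` norm `≤ δ 2^N`; split (v24) into
  `stub_opSem` (operator SEMANTICS: the fibre sums obey the one-step transfer recursion; LANDED p133301) + `stub_uwcOp` (THE OPEN CORE
  in operator form: any family obeying the recursion contracts; λ-free, polynomial-free, finite-state, `pq·4^{R₀-1}` states) +
  the instantiation `uwcW` (proved in this file).  Width `0` of the core is the landed word decay.
* `stub_lowCutKatai_asm` (ASSEMBLY, LANDED p132551): semantics + core + `stub_structureA` (p125264: not `(R,s)`-low ∧ cut rank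
  `< R₀` ⇒ `≥ R/R₀` sequential far pairs) + the dyadic cover `StubDwdOfWords.abs_sum_Ico_le_cover` ⇒ `lowCutKatai`.

See `Lines/Sketch.md` (c4 section) for the mathematics (sparse-limit fibre operators, complementarity of birth/read,
exact-level mass accounting) behind `stub_uwcW`.
-/

set_option linter.dupNamespace false -- D-0017: single-problem summit ⇒ `QuantumAdvantage.QuantumAdvantage` by design

namespace Summit.QuantumAdvantage.QuantumAdvantage.Theorems.MobiusLadderQuadraticDigitPhases

open Finset
open scoped Matrix

open Summit.QuantumAdvantage.QuantumAdvantage.Theorems.MobiusLadderQuadraticDigitPhasesStubWordDecayOfUWC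
  (stub_wordDecayOfUWC)
open Summit.QuantumAdvantage.QuantumAdvantage.Theorems.MobiusLadderQuadraticDigitPhasesStubStationary
  (stub_stationary)
open Summit.QuantumAdvantage.QuantumAdvantage.Theorems.MobiusLadderQuadraticDigitPhasesStubUwcOfNoExact
  (stub_uwcOfNoExact)
open Summit.QuantumAdvantage.QuantumAdvantage.Theorems.MobiusLadderQuadraticDigitPhasesStubNoExactTwistedCycle
  (stub_noExactTwistedCycle)
open Summit.QuantumAdvantage.QuantumAdvantage.Theorems.MobiusLadderQuadraticDigitPhasesReduction
  (quadraticDigitPhases_of_conjectures)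
open Summit.QuantumAdvantage.QuantumAdvantage.Theorems.MobiusLadderQuadraticDigitPhasesStubStructureA
  (stub_structureA)
open Summit.QuantumAdvantage.QuantumAdvantage.Theorems.MobiusLadderQuadraticDigitPhasesStubBlockSum
  (stub_blockSum)
open Summit.QuantumAdvantage.QuantumAdvantage.Theorems.MobiusLadderQuadraticDigitPhasesStubLowCutKataiAsm
  (stub_lowCutKatai_asm)
open Summit.QuantumAdvantage.QuantumAdvantage.Theorems.MobiusLadderQuadraticDigitPhasesStubOpSem
  (stub_opSem)
open Summit.QuantumAdvantage.QuantumAdvantage.Theorems.MobiusLadderQuadraticDigitPhasesStubLossCount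
  (stub_lossCount)
open Summit.QuantumAdvantage.QuantumAdvantage.Theorems.MobiusLadderQuadraticDigitPhasesStubRankLe
  (stub_rankLe)
open Summit.QuantumAdvantage.QuantumAdvantage.Theorems.MobiusLadderQuadraticDigitPhasesStubRankSplit
  (stub_rankSplit)
open Summit.QuantumAdvantage.QuantumAdvantage.Theorems.MobiusLadderQuadraticDigitPhasesStubRankTrunc
  (stub_rankTrunc)
open Summit.QuantumAdvantage.QuantumAdvantage.Theorems.MobiusLadderQuadraticDigitPhasesStubRankAsm
  (stub_rankAsm)
open Summit.QuantumAdvantage.QuantumAdvantage.Theorems.MobiusLadderQuadraticDigitPhasesStubDickson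
  (stub_dickson)
open Summit.QuantumAdvantage.QuantumAdvantage.Theorems.MobiusLadderQuadraticDigitPhasesStubFlipPhase
  (stub_flipPhase)
open Summit.QuantumAdvantage.QuantumAdvantage.Theorems.MobiusLadderQuadraticDigitPhasesStubFlipGood
  (stub_flipGood)
open Summit.QuantumAdvantage.QuantumAdvantage.Theorems.MobiusLadderQuadraticDigitPhasesStubUwcOpCoreFalse
  (stub_uwcOpCoreFalse)
open Summit.QuantumAdvantage.QuantumAdvantage.Theorems.MobiusLadderQuadraticDigitPhasesStubOrbitGauss
  (stub_orbitGauss)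
open Summit.QuantumAdvantage.QuantumAdvantage.Theorems.MobiusLadderQuadraticDigitPhasesStubLabelFourier
  (stub_labelFourier)
open Summit.QuantumAdvantage.QuantumAdvantage.Theorems.MobiusLadderQuadraticDigitPhasesStubEchelonCombos
  (stub_echelonCombos)

/-- STUB (THE OPEN CORE, v41, LABEL-FREE form): COMPLETION-RANK-DRIVEN CANCELLATION AGAINST THE FINAL CARRY CELL.  For
distinct odd primes `p, q` and `δ > 0` there are `s, r` such that for every `s' ≥ s`: if some `s'`-separated row set `B ⊆ [0,N)` of
the symmetrised pattern, restricted to the columns `< N`, has COMPLETION RANK `≥ r` — i.e. EVERY filling `Q` of the punctured near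
band `{(b, j) : b ∈ B, j < N, 0 < dist(b,j) ≤ s'}` leaves rank `≥ r` (equivalently: the rows `b ∈ B` cannot be made to span fewer than
`r` dimensions by editing them inside their own windows) — then the quadratic digital phase
`Φ'(T) = Σ_{i<j<N} a i j (y_i y_j + z_i z_j) + Σ_{i<N} (l₁ i · y_i + l₂ i · z_i)` has `Σ_x |Σ_{T < 2^N, carry cell x} (−1)^{Φ'(T)}| ≤ δ 2^N`.
v37–v40 asked this with the rank of the zero filling only (`Q = 0`, the "far-truncated rank"); that version is FALSE: the adjacent
interleaved product `(Σ_{b∈I} x_b)(Σ_{b∈I} x_{b+1})` has cut rank 2, far-truncated rank `≥ #I − 1` on `B = I` (the truncation of the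
partner `b+1` punches independent holes) and cell sum `→ 2^N/4` (evidence-stub-false-cellCore.md, exp/adjprod.py, kit j022185);
its completion rank is 1.  The completion rank is `≤ 2k` for every `s'`-banded-plus-`k`-products pattern (fill with the truth), so the
hypothesis now genuinely excludes the `(R,s)`-low class, and the structural chain (`stub_crankDickson/Split/Trunc`, `stub_rankAsm2`)
produces it from non-lowness. -/
theorem stub_cellCore2 :
    ∀ p q : ℕ, p.Prime → q.Prime → p ≠ q → 2 < p → 2 < q → ∀ R₀ : ℕ, ∀ δ : ℝ, 0 < δ → ∃ s r : ℕ, ∀ s' : ℕ, s ≤ s' →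
      ∀ (n N : ℕ) (a : ℕ → ℕ → ZMod 2) (l₁ l₂ : ℕ → ZMod 2), N ≤ n → (∀ c : ℕ, (Matrix.of fun (i j : Fin n) => if (i : ℕ) < c ∧ c ≤ (j : ℕ) then a i j else 0).rank < R₀) →
      (∃ B : Finset ℕ, (∀ b ∈ B, b < N) ∧ (∀ b ∈ B, ∀ b' ∈ B, b < b' → s' < b' - b) ∧ ∀ Q : Matrix (Fin n) (Fin n) (ZMod 2), (∀ i j : Fin n, Q i j ≠ 0 → ((i : ℕ) ∈ B ∧ (j : ℕ) < N ∧ 0 < Nat.dist (i : ℕ) (j : ℕ) ∧ Nat.dist (i : ℕ) (j : ℕ) ≤ s')) → r ≤ ((Matrix.of fun (i j : Fin n) => if (i : ℕ) ∈ B ∧ (j : ℕ) < N ∧ s' < Nat.dist (i : ℕ) (j : ℕ) then (if (i : ℕ) < (j : ℕ) then a i j else a j i) else 0) + Q).rank) →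
      ∑ x ∈ Finset.range p ×ˢ Finset.range q, |∑ T ∈ (Finset.range (2 ^ N)).filter (fun T => p * T / 2 ^ N = x.1 ∧ q * T / 2 ^ N = x.2), (if (∑ i ∈ Finset.range N, ∑ j ∈ Finset.range N, (if i < j then a i j * ((if Nat.testBit (p * T) i then (1 : ZMod 2) else 0) * (if Nat.testBit (p * T) j then (1 : ZMod 2) else 0) + (if Nat.testBit (q * T) i then (1 : ZMod 2) else 0) * (if Nat.testBit (q * T) j then (1 : ZMod 2) else 0)) else 0) + ∑ i ∈ Finset.range N, ((l₁ i) * (if Nat.testBit (p * T) i then (1 : ZMod 2) else 0) + (l₂ i) * (if Nat.testBit (q * T) i then (1 : ZMod 2) else 0))) = 1 then (-1 : ℝ) else 1)| ≤ δ * (2 : ℝ) ^ N := by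
  sorry

/-- THE RANK CORE in operator form (v41: completion-rank hypothesis), PROVED from the landed label Fourier reduction
`stub_labelFourier` (p139915) and the label-free cell core `stub_cellCore2`: twist the linear data by the label characters and take
`M := (δ/4^(R₀−1)) 2^N`. -/
theorem stub_rankCore2 :
    ∀ p q : ℕ, p.Prime → q.Prime → p ≠ q → 2 < p → 2 < q → ∀ R₀ : ℕ, ∀ δ : ℝ, 0 < δ → ∃ s r : ℕ, ∀ s' : ℕ, s ≤ s' →
      ∀ (n N : ℕ) (a : ℕ → ℕ → ZMod 2) (l : ℕ → ZMod 2), N ≤ n → (∀ c : ℕ, (Matrix.of fun (i j : Fin n) => if (i : ℕ) < c ∧ c ≤ (j : ℕ) then a i j else 0).rank < R₀) →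
      (∃ B : Finset ℕ, (∀ b ∈ B, b < N) ∧ (∀ b ∈ B, ∀ b' ∈ B, b < b' → s' < b' - b) ∧ ∀ Q : Matrix (Fin n) (Fin n) (ZMod 2), (∀ i j : Fin n, Q i j ≠ 0 → ((i : ℕ) ∈ B ∧ (j : ℕ) < N ∧ 0 < Nat.dist (i : ℕ) (j : ℕ) ∧ Nat.dist (i : ℕ) (j : ℕ) ≤ s')) → r ≤ ((Matrix.of fun (i j : Fin n) => if (i : ℕ) ∈ B ∧ (j : ℕ) < N ∧ s' < Nat.dist (i : ℕ) (j : ℕ) then (if (i : ℕ) < (j : ℕ) then a i j else a j i) else 0) + Q).rank) →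
      ∀ μ : ℕ → ℕ × ℕ → (Fin n → ZMod 2) → (Fin n → ZMod 2) → ℝ, (∀ x π π', μ 0 x π π' = if x = (0, 0) ∧ π = 0 ∧ π' = 0 then 1 else 0) →
      (∀ N', N' < N → ∀ x' ρ ρ', μ (N' + 1) x' ρ ρ' =
          ∑ x ∈ Finset.range p ×ˢ Finset.range q, ∑ π : Fin n → ZMod 2, ∑ π' : Fin n → ZMod 2, ∑ t ∈ Finset.range 2,
            (if ((p * t + x.1) / 2 = x'.1 ∧ (q * t + x.2) / 2 = x'.2 ∧ (fun j : Fin n => if N' + 1 ≤ (j : ℕ) then π j + a N' (j : ℕ) * (if (p * t + x.1) % 2 = 1 then (1 : ZMod 2) else 0) else 0) = ρ ∧ (fun j : Fin n => if N' + 1 ≤ (j : ℕ) then π' j + a N' (j : ℕ) * (if (q * t + x.2) % 2 = 1 then (1 : ZMod 2) else 0) else 0) = ρ') then (if (if (p * t + x.1) % 2 = 1 then (1 : ZMod 2) else 0) * ((if h : N' < n then π ⟨N', h⟩ else 0) + l N') + (if (q * t + x.2) % 2 = 1 then (1 : ZMod 2) else 0) * ((if h : N' < n then π' ⟨N', h⟩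 else 0) + l N') = 1 then (-1 : ℝ) else 1) * μ N' x π π' else 0)) →
      ∑ x ∈ Finset.range p ×ˢ Finset.range q, ∑ π : Fin n → ZMod 2, ∑ π' : Fin n → ZMod 2, |μ N x π π'| ≤ δ * (2 : ℝ) ^ N := by
  intro p q hp hq hne h2p h2q R₀ δ hδ
  obtain ⟨s, r, hsr⟩ := stub_cellCore2 p q hp hq hne h2p h2q R₀ (δ / (4 : ℝ) ^ (R₀ - 1)) (by positivity)
  refine ⟨s, r, fun s' hs' n N a l hN hcut hB μ h0 hrec => ?_⟩
  have key := stub_labelFourier p q n N R₀ a l (δ / (4 : ℝ) ^ (R₀ - 1) * (2 : ℝ) ^ N) hp.pos hq.pos hN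
    (by simpa using hcut N) (fun ψ ψ' => hsr s' hs' n N a _ _ hN hcut hB) μ h0 hrec
  calc _ ≤ (4 : ℝ) ^ (R₀ - 1) * (δ / (4 : ℝ) ^ (R₀ - 1) * (2 : ℝ) ^ N) := key
    _ = δ * (2 : ℝ) ^ N := by field_simp

/-- STUB (staged MILESTONE toward `stub_cellCore`, §3.6–3.7; provable from landed/staged pieces): the TAME CELL CORE — the cell-core
analogue of `stub_tameCore` (no transfer recursion, no labels, hence NO kernel/tail conditions: rows alive beyond `N` are irrelevant).
Band-local windows (every `j ∈ (b, b+L]` interacts with positions `< N` only within distance `s''`), separation `> L + 2 s'' + k + 1`, and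
`r` subsets `u i ⊆ B` with pivots `m i < N`: symmetrised rows of `u i` sum to `1` at `m i` and to `0` on `(m i, N)`, members `> L + s''`
below the pivot or with inert windows (no interactions `< N`, no linear data), pivots increasing with gaps `> k` ⇒
`Σ_x |Σ_{T<2^N, cell x} (−1)^{Φ'(T)}| ≤ δ 2^N`.  Proof as for `stub_tameCore` with `stub_orbitCancel` applied per CARRY-CELL fibre (the flips
never change the cell since `b + L < N`).  Validated: exp/celltame_check.py (β = 0 and the bound on pairs, pairs+spoilers, RS+pairs,
asymmetric linear data, dense join tails, E₂ with pair certificates, E₂+tails). -/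
theorem stub_cellTame :
    ∀ p q : ℕ, p.Prime → q.Prime → p ≠ q → 2 < p → 2 < q → ∀ δ : ℝ, 0 < δ → ∃ r k : ℕ,
      ∀ (L s'' N : ℕ) (a : ℕ → ℕ → ZMod 2) (l₁ l₂ : ℕ → ZMod 2) (B : Finset ℕ) (u : ℕ → Finset ℕ) (m : ℕ → ℕ),
      (B.card : ℝ) * (p + q + 2) ≤ δ * 2 ^ L →
      (∀ b ∈ B, b + L < N) → (∀ b ∈ B, ∀ b' ∈ B, b < b' → L + 2 * s'' + k + 1 < b' - b) →
      (∀ b ∈ B, ∀ j, b < j → j ≤ b + L → ∀ i, i < N → (a i j ≠ 0 ∨ a j i ≠ 0) → Nat.dist i j ≤ s'') →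
      (∀ i, i < r → u i ⊆ B ∧ m i < N ∧
        (∑ b ∈ u i, (fun b j : ℕ => if b < j then a b j else if j < b then a j b else 0) b (m i)) = 1 ∧
        (∀ j, m i < j → j < N → (∑ b ∈ u i, (fun b j : ℕ => if b < j then a b j else if j < b then a j b else 0) b j) = 0) ∧
        (∀ b ∈ u i, b + L + s'' < m i ∨ (∀ j, b < j → j ≤ b + L → l₁ j = 0 ∧ l₂ j = 0 ∧ ∀ i', i' < N → a i' j = 0 ∧ a j i' = 0))) →
      (∀ i, i + 1 < r → m i + k < m (i + 1)) →
      ∑ x ∈ Finset.range p ×ˢ Finset.range q, |∑ T ∈ (Finset.range (2 ^ N)).filter (fun T => p * T / 2 ^ N = x.1 ∧ q * T / 2 ^ N = x.2), (if (∑ i ∈ Finset.range N, ∑ j ∈ Finset.range N, (if i < j then a i j * ((if Nat.testBit (p * T) i then (1 : ZMod 2) else 0) * (if Nat.testBit (p * T) j then (1 : ZMod 2) else 0) + (if Nat.testBit (q * T) i then (1 : ZMod 2) else 0) * (if Nat.testBit (q * T) j then (1 : ZMod 2) else 0)) else 0) + ∑ i ∈ Finset.range N, ((l₁ i) * (if Nat.testBit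 (p * T) i then (1 : ZMod 2) else 0) + (l₂ i) * (if Nat.testBit (q * T) i then (1 : ZMod 2) else 0))) = 1 then (-1 : ℝ) else 1)| ≤ δ * (2 : ℝ) ^ N := by
  sorry

/-- STUB (ASSEMBLY v41; provable — a copy of the landed `stub_rankAsm` (p137191) with the Dickson axiom weakened to
`2R ≤ (16 s + 5) · rk (range n)` and accordingly `R := (16 S + 5)(S + 1)(G + L + R₀ + 1)`): LOW-cut Kátai from an abstract rank
functional `rk` with the four axioms (weak Dickson, split, truncation, `≤ #B`), the block bound and the rank core. -/
theorem stub_rankAsm2 :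
    ∀ (F : (n : ℕ) → MvPolynomial (Fin n) (ZMod 2) → ℕ → ℕ → ℝ)
      (L1 : (n : ℕ) → MvPolynomial (Fin n) (ZMod 2) → ℕ → ℕ → ℕ → ℝ)
      (cut : (n : ℕ) → MvPolynomial (Fin n) (ZMod 2) → ℕ → Prop)
      (low : (n : ℕ) → MvPolynomial (Fin n) (ZMod 2) → ℕ → ℕ → Prop)
      (rk : (n : ℕ) → MvPolynomial (Fin n) (ZMod 2) → ℕ → Finset ℕ → ℕ → ℕ),
    (∀ n P p m, |F n P p m| ≤ 1) →
    (∀ (p q n N : ℕ) (P : MvPolynomial (Fin n) (ZMod 2)), P.totalDegree ≤ 2 → N ≤ n → 0 < p → 0 < q → ∀ mhi : ℕ,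
      |∑ T ∈ Finset.range (2 ^ N), F n P p (mhi * 2 ^ N + T) * F n P q (mhi * 2 ^ N + T)| ≤ L1 n P p q N) →
    (∀ p q : ℕ, p.Prime → q.Prime → p ≠ q → 2 < p → 2 < q → ∀ R₀ : ℕ, ∀ δ : ℝ, 0 < δ → ∃ s r : ℕ, ∀ s' : ℕ, s ≤ s' →
      ∀ (n N : ℕ) (P : MvPolynomial (Fin n) (ZMod 2)), N ≤ n → cut n P R₀ →
      (∃ B : Finset ℕ, (∀ b ∈ B, b < N) ∧ (∀ b ∈ B, ∀ b' ∈ B, b < b' → s' < b' - b) ∧ r ≤ rk n P s' B N) →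
      L1 n P p q N ≤ δ * (2 : ℝ) ^ N) →
    (∀ (n : ℕ) (P : MvPolynomial (Fin n) (ZMod 2)) (R s : ℕ), P.totalDegree ≤ 2 → ¬ low n P R s →
      2 * R ≤ (16 * s + 5) * rk n P s (Finset.range n) n) →
    (∀ (n : ℕ) (P : MvPolynomial (Fin n) (ZMod 2)) (s : ℕ) (B : Finset ℕ) (N m : ℕ), 0 < m →
      rk n P s B N ≤ ∑ c ∈ Finset.range m, rk n P s (B.filter (fun b => b % m = c)) N) →
    (∀ (n : ℕ) (P : MvPolynomial (Fin n) (ZMod 2)) (s R₀ : ℕ) (B : Finset ℕ) (N : ℕ), N ≤ n → cut n P R₀ →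
      (∀ b ∈ B, ∀ b' ∈ B, b < b' → s < b' - b) →
      rk n P s B n ≤ rk n P s (B.filter (fun b => b < N)) N + (B.filter (fun b => N ≤ b)).card + R₀) →
    (∀ (n : ℕ) (P : MvPolynomial (Fin n) (ZMod 2)) (s : ℕ) (B : Finset ℕ) (N : ℕ), rk n P s B N ≤ B.card) →
    ∀ B : ℕ, ∀ τ : ℝ, 0 < τ → ∀ R₀ : ℕ, ∃ R s : ℕ, ∀ n : ℕ, ∀ P : MvPolynomial (Fin n) (ZMod 2),
      P.totalDegree ≤ 2 → cut n P R₀ → ¬ low n P R s →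
      ∀ p q : ℕ, p.Prime → q.Prime → p ≠ q → 2 < p → 2 < q → p ≤ B → q ≤ B →
      ∀ M : ℕ, M ≤ 2 ^ n → 2 ^ n ≤ 2 * B * M →
        |∑ m ∈ Finset.Icc 1 M, F n P p m * F n P q m| ≤ τ * M := by
  sorry

/-- STUB (structural, v41; provable, Mathlib + the public lemmas `exists_symplectic_of_rank_le`, `low_of_symplectic` of the landed
`…StubDickson`, p137348): WEAK DICKSON FOR THE COMPLETION RANK.  If `P` is not `(R,s)`-low then for EVERY zero-diagonal `s`-banded
(not necessarily symmetric) filling `Qm`, `2R ≤ (16 s + 5) · rank(Far_s + Qm)`.  Proof: `M := Far_s + Qm` has rank `k`; `E := M + Mᵀ =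
Q̃ + Q̃ᵀ` (`Q̃ := Qm +` near part of the symmetrised coefficient matrix `A`) is alternating, `s`-banded, of rank `≤ 2k`, so its nonzero
rows form a set `Z` with `#Z ≤ (4s+1)·2k` (rows of `E` at mutual distance `> 2s` have disjoint supports and are independent); with `D`
the diagonal projector off `Z`, `DMD` is symmetric (as `DED = 0`), zero-diagonal, of rank `≤ k`, `DQ̃D = DAD − DMD` is alternating and
`s`-banded, and `A − DQ̃D = (A − DAD) + DMD` is alternating of rank `≤ 2#Z + k ≤ (16s+5)k` with the same far (`dist > s`) entries as `A`;
Dickson (`exists_symplectic_of_rank_le`) and `low_of_symplectic` then make `P` `(h+1, s)`-low with `2h ≤ (16 s + 5) k`. -/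
theorem stub_crankDickson :
    ∀ (n : ℕ) (P : MvPolynomial (Fin n) (ZMod 2)) (R s : ℕ), P.totalDegree ≤ 2 →
      ¬ (∃ Q : MvPolynomial (Fin n) (ZMod 2), Q.totalDegree ≤ 2 ∧ (∀ m ∈ Q.support, ∀ i ∈ m.support, ∀ j ∈ m.support, Nat.dist i j ≤ s) ∧ ∃ k : ℕ, k < R ∧ ∃ u v : Fin k → Fin n → ZMod 2, ∀ x : Fin n → ZMod 2, MvPolynomial.eval x P = MvPolynomial.eval x Q + ∑ t : Fin k, (∑ i : Fin n, u t i * x i) * (∑ i : Fin n, v t i * x i)) →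
      ∀ Qm : Matrix (Fin n) (Fin n) (ZMod 2), (∀ i j : Fin n, Qm i j ≠ 0 → ((i : ℕ) ∈ Finset.range n ∧ (j : ℕ) < n ∧ 0 < Nat.dist (i : ℕ) (j : ℕ) ∧ Nat.dist (i : ℕ) (j : ℕ) ≤ s)) →
      2 * R ≤ (16 * s + 5) * ((Matrix.of fun (i j : Fin n) => if (i : ℕ) ∈ Finset.range n ∧ (j : ℕ) < n ∧ s < Nat.dist (i : ℕ) (j : ℕ) then MvPolynomial.coeff (Finsupp.single i 1 + Finsupp.single j 1) P else 0) + Qm).rank := by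
  sorry

/-- STUB (structural, v41; provable, Mathlib only — cf. the landed `stub_rankSplit`, p137085): SPLIT FOR FILLINGS.  Fillings of the
residue classes of `B` mod `m` glue (the rows are disjoint) to a filling of `B`, and the glued matrix `Far_B + Σ_c Qc c` is the sum over
`c < m` of the class matrices `Far_{B_c} + Qc c`, so its rank is at most the sum of their ranks. -/
theorem stub_crankSplit :
    ∀ (n : ℕ) (P : MvPolynomial (Fin n) (ZMod 2)) (s : ℕ) (B : Finset ℕ) (N m : ℕ), 0 < m →
      ∀ Qc : ℕ → Matrix (Fin n) (Fin n) (ZMod 2),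
      (∀ c, c < m → (∀ i j : Fin n, Qc c i j ≠ 0 → ((i : ℕ) ∈ (B.filter (fun b => b % m = c)) ∧ (j : ℕ) < N ∧ 0 < Nat.dist (i : ℕ) (j : ℕ) ∧ Nat.dist (i : ℕ) (j : ℕ) ≤ s))) →
      (∀ i j : Fin n, (∑ c ∈ Finset.range m, Qc c) i j ≠ 0 → ((i : ℕ) ∈ B ∧ (j : ℕ) < N ∧ 0 < Nat.dist (i : ℕ) (j : ℕ) ∧ Nat.dist (i : ℕ) (j : ℕ) ≤ s)) ∧
      ((Matrix.of fun (i j : Fin n) => if (i : ℕ) ∈ B ∧ (j : ℕ) < N ∧ s < Nat.dist (i : ℕ) (j : ℕ) then MvPolynomial.coeff (Finsupp.single i 1 + Finsupp.single j 1) P else 0) + ∑ c ∈ Finset.range m, Qc c).rank ≤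
        ∑ c ∈ Finset.range m, ((Matrix.of fun (i j : Fin n) => if (i : ℕ) ∈ (B.filter (fun b => b % m = c)) ∧ (j : ℕ) < N ∧ s < Nat.dist (i : ℕ) (j : ℕ) then MvPolynomial.coeff (Finsupp.single i 1 + Finsupp.single j 1) P else 0) + Qc c).rank := by
  sorry

/-- STUB (structural, v41; provable, Mathlib only — cf. the landed `stub_rankTrunc`, p137093): TRUNCATION FOR FILLINGS.  A filling of
the rows `B ∩ [0,N)` inside the columns `< N` is also a filling of `B` inside the columns `< n`, and passing from the truncated matrix at
`N` to the full one adds at most `#(B ∩ [N,n))` (new rows) `+ R₀` (columns `≥ N` of the rows `< N`: the cut matrix at `N`, of rank `< R₀`,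
minus its near part, which lives in the single row of the `s`-separated `B` within distance `s` below `N`). -/
theorem stub_crankTrunc :
    ∀ (n : ℕ) (P : MvPolynomial (Fin n) (ZMod 2)) (s R₀ : ℕ) (B : Finset ℕ) (N : ℕ), N ≤ n → (∀ c : ℕ, (Matrix.of fun (i j : Fin n) => if (i : ℕ) < c ∧ c ≤ (j : ℕ) then MvPolynomial.coeff (Finsupp.single i 1 + Finsupp.single j 1) P else 0).rank < R₀) →
      (∀ b ∈ B, ∀ b' ∈ B, b < b' → s < b' - b) →
      ∀ Qm : Matrix (Fin n) (Fin n) (ZMod 2), (∀ i j : Fin n, Qm i j ≠ 0 → ((i : ℕ) ∈ (B.filter (fun b => b < N)) ∧ (j : ℕ) < N ∧ 0 < Nat.dist (i : ℕ) (j : ℕ) ∧ Nat.dist (i : ℕ) (j : ℕ) ≤ s)) →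
      (∀ i j : Fin n, Qm i j ≠ 0 → ((i : ℕ) ∈ B ∧ (j : ℕ) < n ∧ 0 < Nat.dist (i : ℕ) (j : ℕ) ∧ Nat.dist (i : ℕ) (j : ℕ) ≤ s)) ∧
      ((Matrix.of fun (i j : Fin n) => if (i : ℕ) ∈ B ∧ (j : ℕ) < n ∧ s < Nat.dist (i : ℕ) (j : ℕ) then MvPolynomial.coeff (Finsupp.single i 1 + Finsupp.single j 1) P else 0) + Qm).rank ≤
        ((Matrix.of fun (i j : Fin n) => if (i : ℕ) ∈ (B.filter (fun b => b < N)) ∧ (j : ℕ) < N ∧ s < Nat.dist (i : ℕ) (j : ℕ) then MvPolynomial.coeff (Finsupp.single i 1 + Finsupp.single j 1) P else 0) + Qm).rank + (B.filter (fun b => N ≤ b)).card + R₀ := by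
  sorry

/-- The completion rank is attained by some filling (the set of filled ranks is nonempty: `Q = 0`). -/
theorem crank_attained (n : ℕ) (P : MvPolynomial (Fin n) (ZMod 2)) (s : ℕ) (B : Finset ℕ) (N : ℕ) :
    ∃ Q : Matrix (Fin n) (Fin n) (ZMod 2), (∀ i j : Fin n, Q i j ≠ 0 → ((i : ℕ) ∈ B ∧ (j : ℕ) < N ∧ 0 < Nat.dist (i : ℕ) (j : ℕ) ∧ Nat.dist (i : ℕ) (j : ℕ) ≤ s)) ∧
      ((Matrix.of fun (i j : Fin n) => if (i : ℕ) ∈ B ∧ (j : ℕ) < N ∧ s < Nat.dist (i : ℕ) (j : ℕ) then MvPolynomial.coeff (Finsupp.single i 1 + Finsupp.single j 1) P else 0) + Q).rank = sInf {k : ℕ | ∃ Q : Matrix (Fin n) (Fin n) (ZMod 2), (∀ i j : Fin n, Q i j ≠ 0 → ((i : ℕ) ∈ B ∧ (j : ℕ) < N ∧ 0 < Nat.dist (i : ℕ) (j : ℕ) ∧ Nat.dist (i : ℕ) (j : ℕ) ≤ s)) ∧ ((Matrix.of fun (i j : Fin n) => if (i : ℕ) ∈ B ∧ (j : ℕ)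 < N ∧ s < Nat.dist (i : ℕ) (j : ℕ) then MvPolynomial.coeff (Finsupp.single i 1 + Finsupp.single j 1) P else 0) + Q).rank = k} := by
  have hne : ({k : ℕ | ∃ Q : Matrix (Fin n) (Fin n) (ZMod 2), (∀ i j : Fin n, Q i j ≠ 0 → ((i : ℕ) ∈ B ∧ (j : ℕ) < N ∧ 0 < Nat.dist (i : ℕ) (j : ℕ) ∧ Nat.dist (i : ℕ) (j : ℕ) ≤ s)) ∧ ((Matrix.of fun (i j : Fin n) => if (i : ℕ) ∈ B ∧ (j : ℕ) < N ∧ s < Nat.dist (i : ℕ) (j : ℕ) then MvPolynomial.coeff (Finsupp.single i 1 + Finsupp.single j 1) P else 0) + Q).rank = k}).Nonempty :=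
    ⟨_, 0, fun i j h => absurd rfl h, rfl⟩
  exact Nat.sInf_mem hne

/-- Every filling bounds the completion rank from above. -/
theorem crank_le_rank (n : ℕ) (P : MvPolynomial (Fin n) (ZMod 2)) (s : ℕ) (B : Finset ℕ) (N : ℕ)
    (Q : Matrix (Fin n) (Fin n) (ZMod 2)) (hQ : (∀ i j : Fin n, Q i j ≠ 0 → ((i : ℕ) ∈ B ∧ (j : ℕ) < N ∧ 0 < Nat.dist (i : ℕ) (j : ℕ) ∧ Nat.dist (i : ℕ) (j : ℕ) ≤ s))) :
    sInf {k : ℕ | ∃ Q : Matrix (Fin n) (Fin n) (ZMod 2), (∀ i j : Fin n, Q i j ≠ 0 → ((i : ℕ) ∈ B ∧ (j : ℕ) < N ∧ 0 < Nat.dist (i : ℕ) (j : ℕ) ∧ Nat.dist (i : ℕ) (j : ℕ) ≤ s)) ∧ ((Matrix.of fun (i j : Fin n) => if (i : ℕ) ∈ B ∧ (j : ℕ) < N ∧ s < Nat.dist (i : ℕ) (j : ℕ) then MvPolynomial.coeff (Finsupp.single i 1 + Finsupp.single j 1) P else 0) + Q).rank = k} ≤ ((Matrix.of fun (i j : Fin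 n) => if (i : ℕ) ∈ B ∧ (j : ℕ) < N ∧ s < Nat.dist (i : ℕ) (j : ℕ) then MvPolynomial.coeff (Finsupp.single i 1 + Finsupp.single j 1) P else 0) + Q).rank :=
  Nat.sInf_le ⟨Q, hQ, rfl⟩

/-- Weak Dickson for the completion rank (from `stub_crankDickson`). -/
theorem crank_dickson :
    ∀ (n : ℕ) (P : MvPolynomial (Fin n) (ZMod 2)) (R s : ℕ), P.totalDegree ≤ 2 →
      ¬ (∃ Q : MvPolynomial (Fin n) (ZMod 2), Q.totalDegree ≤ 2 ∧ (∀ m ∈ Q.support, ∀ i ∈ m.support, ∀ j ∈ m.support, Nat.dist i j ≤ s) ∧ ∃ k : ℕ, k < R ∧ ∃ u v : Fin k → Fin n → ZMod 2, ∀ x : Fin n → ZMod 2, MvPolynomial.eval x P = MvPolynomial.eval x Q + ∑ t : Fin k, (∑ i : Fin n, u t i * x i) * (∑ i : Fin n, v t i * x i)) →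
      2 * R ≤ (16 * s + 5) * (fun n (P : MvPolynomial (Fin n) (ZMod 2)) s B N => sInf {k : ℕ | ∃ Q : Matrix (Fin n) (Fin n) (ZMod 2), (∀ i j : Fin n, Q i j ≠ 0 → ((i : ℕ) ∈ B ∧ (j : ℕ) < N ∧ 0 < Nat.dist (i : ℕ) (j : ℕ) ∧ Nat.dist (i : ℕ) (j : ℕ) ≤ s)) ∧ ((Matrix.of fun (i j : Fin n) => if (i : ℕ) ∈ B ∧ (j : ℕ) < N ∧ s < Nat.dist (i : ℕ) (j : ℕ) then MvPolynomial.coeff (Finsupp.single i 1 + Finsupp.single j 1) P else 0) + Q).rank = k}) n P s (Finset.range n) n := by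
  intro n P R s hP hlow
  obtain ⟨Q, hQ, hk⟩ := crank_attained n P s (Finset.range n) n
  show 2 * R ≤ (16 * s + 5) * sInf {k : ℕ | ∃ Q : Matrix (Fin n) (Fin n) (ZMod 2), (∀ i j : Fin n, Q i j ≠ 0 → ((i : ℕ) ∈ (Finset.range n) ∧ (j : ℕ) < n ∧ 0 < Nat.dist (i : ℕ) (j : ℕ) ∧ Nat.dist (i : ℕ) (j : ℕ) ≤ s)) ∧ ((Matrix.of fun (i j : Fin n) => if (i : ℕ) ∈ (Finset.range n) ∧ (j : ℕ) < n ∧ s < Nat.dist (i : ℕ) (j : ℕ) then MvPolynomial.coeff (Finsupp.single i 1 + Finsupp.single j 1) P else 0) + Q).rank = k}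
  rw [← hk]
  exact stub_crankDickson n P R s hP hlow Q hQ

/-- Split over residue classes for the completion rank (from `stub_crankSplit`). -/
theorem crank_split :
    ∀ (n : ℕ) (P : MvPolynomial (Fin n) (ZMod 2)) (s : ℕ) (B : Finset ℕ) (N m : ℕ), 0 < m →
      (fun n (P : MvPolynomial (Fin n) (ZMod 2)) s B N => sInf {k : ℕ | ∃ Q : Matrix (Fin n) (Fin n) (ZMod 2), (∀ i j : Fin n, Q i j ≠ 0 → ((i : ℕ) ∈ B ∧ (j : ℕ) < N ∧ 0 < Nat.dist (i : ℕ) (j : ℕ) ∧ Nat.dist (i : ℕ) (j : ℕ) ≤ s)) ∧ ((Matrix.of fun (i j : Fin n) => if (i : ℕ) ∈ B ∧ (j : ℕ) < N ∧ s < Nat.dist (i : ℕ) (j : ℕ) then MvPolynomial.coeff (Finsupp.single i 1 + Finsupp.single j 1) P else 0) + Q).rank = k}) n P s B N ≤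
        ∑ c ∈ Finset.range m, (fun n (P : MvPolynomial (Fin n) (ZMod 2)) s B N => sInf {k : ℕ | ∃ Q : Matrix (Fin n) (Fin n) (ZMod 2), (∀ i j : Fin n, Q i j ≠ 0 → ((i : ℕ) ∈ B ∧ (j : ℕ) < N ∧ 0 < Nat.dist (i : ℕ) (j : ℕ) ∧ Nat.dist (i : ℕ) (j : ℕ) ≤ s)) ∧ ((Matrix.of fun (i j : Fin n) => if (i : ℕ) ∈ B ∧ (j : ℕ) < N ∧ s < Nat.dist (i : ℕ) (j : ℕ) then MvPolynomial.coeff (Finsupp.single i 1 + Finsupp.single j 1) P else 0) + Q).rank = k}) n P s (B.filter (fun b => b % m = c)) N := by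
  intro n P s B N m hm
  have hc : ∀ c : ℕ, ∃ Q : Matrix (Fin n) (Fin n) (ZMod 2), (∀ i j : Fin n, Q i j ≠ 0 → ((i : ℕ) ∈ (B.filter (fun b => b % m = c)) ∧ (j : ℕ) < N ∧ 0 < Nat.dist (i : ℕ) (j : ℕ) ∧ Nat.dist (i : ℕ) (j : ℕ) ≤ s)) ∧
      ((Matrix.of fun (i j : Fin n) => if (i : ℕ) ∈ (B.filter (fun b => b % m = c)) ∧ (j : ℕ) < N ∧ s < Nat.dist (i : ℕ) (j : ℕ) then MvPolynomial.coeff (Finsupp.single i 1 + Finsupp.single j 1) P else 0) + Q).rank = sInf {k : ℕ | ∃ Q : Matrix (Fin n) (Fin n) (ZMod 2), (∀ i j : Fin n, Q i j ≠ 0 → ((i : ℕ) ∈ (B.filter (fun b => b % m = c)) ∧ (j : ℕ) < N ∧ 0 < Nat.dist (i : ℕ) (j : ℕ) ∧ Nat.dist (i : ℕ) (j : ℕ) ≤ s)) ∧ ((Matrix.of fun (i j : Fin n) => if (i : ℕ) ∈ (B.filter (fun b => b % m = c)) ∧ (j : ℕ) < N ∧ s < Nat.dist (i : ℕ) (j :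 ℕ) then MvPolynomial.coeff (Finsupp.single i 1 + Finsupp.single j 1) P else 0) + Q).rank = k} :=
    fun c => crank_attained n P s (B.filter (fun b => b % m = c)) N
  choose Qc hQc hrk using hc
  obtain ⟨hfill, hle⟩ := stub_crankSplit n P s B N m hm Qc (fun c _ => hQc c)
  show sInf {k : ℕ | ∃ Q : Matrix (Fin n) (Fin n) (ZMod 2), (∀ i j : Fin n, Q i j ≠ 0 → ((i : ℕ) ∈ B ∧ (j : ℕ) < N ∧ 0 < Nat.dist (i : ℕ) (j : ℕ) ∧ Nat.dist (i : ℕ) (j : ℕ) ≤ s)) ∧ ((Matrix.of fun (i j : Fin n) => if (i : ℕ) ∈ B ∧ (j : ℕ) < N ∧ s < Nat.dist (i : ℕ) (j : ℕ) then MvPolynomial.coeff (Finsupp.single i 1 + Finsupp.single j 1) P else 0) + Q).rank = k} ≤ ∑ c ∈ Finset.range m, sInf {k : ℕ | ∃ Q : Matrix (Fin n) (Fin n) (ZMod 2), (∀ i j : Fin n, Q i j ≠ 0 → ((i : ℕ) ∈ (B.filter (fun b => b % m = c)) ∧ (j : ℕ) < N ∧ 0 < Nat.dist (i : ℕ) (j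 : ℕ) ∧ Nat.dist (i : ℕ) (j : ℕ) ≤ s)) ∧ ((Matrix.of fun (i j : Fin n) => if (i : ℕ) ∈ (B.filter (fun b => b % m = c)) ∧ (j : ℕ) < N ∧ s < Nat.dist (i : ℕ) (j : ℕ) then MvPolynomial.coeff (Finsupp.single i 1 + Finsupp.single j 1) P else 0) + Q).rank = k}
  calc _ ≤ _ := crank_le_rank n P s B N _ hfill
    _ ≤ _ := hle
    _ = _ := Finset.sum_congr rfl fun c _ => hrk c

/-- Truncation for the completion rank (from `stub_crankTrunc`). -/
theorem crank_trunc :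
    ∀ (n : ℕ) (P : MvPolynomial (Fin n) (ZMod 2)) (s R₀ : ℕ) (B : Finset ℕ) (N : ℕ), N ≤ n → (∀ c : ℕ, (Matrix.of fun (i j : Fin n) => if (i : ℕ) < c ∧ c ≤ (j : ℕ) then MvPolynomial.coeff (Finsupp.single i 1 + Finsupp.single j 1) P else 0).rank < R₀) →
      (∀ b ∈ B, ∀ b' ∈ B, b < b' → s < b' - b) →
      (fun n (P : MvPolynomial (Fin n) (ZMod 2)) s B N => sInf {k : ℕ | ∃ Q : Matrix (Fin n) (Fin n) (ZMod 2), (∀ i j : Fin n, Q i j ≠ 0 → ((i : ℕ) ∈ B ∧ (j : ℕ) < N ∧ 0 < Nat.dist (i : ℕ) (j : ℕ) ∧ Nat.dist (i : ℕ) (j : ℕ) ≤ s)) ∧ ((Matrix.of fun (i j : Fin n) => if (i : ℕ) ∈ B ∧ (j : ℕ) < N ∧ s < Nat.dist (i : ℕ) (j : ℕ) then MvPolynomial.coeff (Finsupp.single i 1 + Finsupp.single j 1) P else 0) + Q).rank = k}) n P s B n ≤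
        (fun n (P : MvPolynomial (Fin n) (ZMod 2)) s B N => sInf {k : ℕ | ∃ Q : Matrix (Fin n) (Fin n) (ZMod 2), (∀ i j : Fin n, Q i j ≠ 0 → ((i : ℕ) ∈ B ∧ (j : ℕ) < N ∧ 0 < Nat.dist (i : ℕ) (j : ℕ) ∧ Nat.dist (i : ℕ) (j : ℕ) ≤ s)) ∧ ((Matrix.of fun (i j : Fin n) => if (i : ℕ) ∈ B ∧ (j : ℕ) < N ∧ s < Nat.dist (i : ℕ) (j : ℕ) then MvPolynomial.coeff (Finsupp.single i 1 + Finsupp.single j 1) P else 0) + Q).rank = k}) n P s (B.filter (fun b => b < N)) N + (B.filter (fun b => N ≤ b)).card + R₀ := by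
  intro n P s R₀ B N hN hcut hsep
  obtain ⟨Q, hQ, hk⟩ := crank_attained n P s (B.filter (fun b => b < N)) N
  obtain ⟨hfill, hle⟩ := stub_crankTrunc n P s R₀ B N hN hcut hsep Q hQ
  show sInf {k : ℕ | ∃ Q : Matrix (Fin n) (Fin n) (ZMod 2), (∀ i j : Fin n, Q i j ≠ 0 → ((i : ℕ) ∈ B ∧ (j : ℕ) < n ∧ 0 < Nat.dist (i : ℕ) (j : ℕ) ∧ Nat.dist (i : ℕ) (j : ℕ) ≤ s)) ∧ ((Matrix.of fun (i j : Fin n) => if (i : ℕ) ∈ B ∧ (j : ℕ) < n ∧ s < Nat.dist (i : ℕ) (j : ℕ) then MvPolynomial.coeff (Finsupp.single i 1 + Finsupp.single j 1) P else 0) + Q).rank = k} ≤ sInf {k : ℕ | ∃ Q : Matrix (Fin n) (Fin n) (ZMod 2), (∀ i j : Fin n, Q i j ≠ 0 → ((i : ℕ) ∈ (B.filter (fun b => b < N)) ∧ (j : ℕ) < N ∧ 0 < Nat.dist (i : ℕ) (j : ℕ) ∧ Nat.dist (i : ℕ) (j : ℕ) ≤ s)) ∧ ((Matrix.of fun (i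 j : Fin n) => if (i : ℕ) ∈ (B.filter (fun b => b < N)) ∧ (j : ℕ) < N ∧ s < Nat.dist (i : ℕ) (j : ℕ) then MvPolynomial.coeff (Finsupp.single i 1 + Finsupp.single j 1) P else 0) + Q).rank = k} + (B.filter (fun b => N ≤ b)).card + R₀
  rw [← hk]
  exact (crank_le_rank n P s B n Q hfill).trans hle

/-- The completion rank is at most `#B` (zero filling + the landed `stub_rankLe`, p137006). -/
theorem crank_le :
    ∀ (n : ℕ) (P : MvPolynomial (Fin n) (ZMod 2)) (s : ℕ) (B : Finset ℕ) (N : ℕ),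
      (fun n (P : MvPolynomial (Fin n) (ZMod 2)) s B N => sInf {k : ℕ | ∃ Q : Matrix (Fin n) (Fin n) (ZMod 2), (∀ i j : Fin n, Q i j ≠ 0 → ((i : ℕ) ∈ B ∧ (j : ℕ) < N ∧ 0 < Nat.dist (i : ℕ) (j : ℕ) ∧ Nat.dist (i : ℕ) (j : ℕ) ≤ s)) ∧ ((Matrix.of fun (i j : Fin n) => if (i : ℕ) ∈ B ∧ (j : ℕ) < N ∧ s < Nat.dist (i : ℕ) (j : ℕ) then MvPolynomial.coeff (Finsupp.single i 1 + Finsupp.single j 1) P else 0) + Q).rank = k}) n P s B N ≤ B.card := by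
  intro n P s B N
  show sInf {k : ℕ | ∃ Q : Matrix (Fin n) (Fin n) (ZMod 2), (∀ i j : Fin n, Q i j ≠ 0 → ((i : ℕ) ∈ B ∧ (j : ℕ) < N ∧ 0 < Nat.dist (i : ℕ) (j : ℕ) ∧ Nat.dist (i : ℕ) (j : ℕ) ≤ s)) ∧ ((Matrix.of fun (i j : Fin n) => if (i : ℕ) ∈ B ∧ (j : ℕ) < N ∧ s < Nat.dist (i : ℕ) (j : ℕ) then MvPolynomial.coeff (Finsupp.single i 1 + Finsupp.single j 1) P else 0) + Q).rank = k} ≤ B.card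
  calc _ ≤ ((Matrix.of fun (i j : Fin n) => if (i : ℕ) ∈ B ∧ (j : ℕ) < N ∧ s < Nat.dist (i : ℕ) (j : ℕ) then MvPolynomial.coeff (Finsupp.single i 1 + Finsupp.single j 1) P else 0) + 0).rank := crank_le_rank n P s B N 0 (fun i j h => absurd rfl h)
    _ = (Matrix.of fun (i j : Fin n) => if (i : ℕ) ∈ B ∧ (j : ℕ) < N ∧ s < Nat.dist (i : ℕ) (j : ℕ) then MvPolynomial.coeff (Finsupp.single i 1 + Finsupp.single j 1) P else 0).rank := by rw [add_zero]
    _ ≤ B.card := stub_rankLe n P s B N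

/-- The concrete form of the rank core (hypothesis `hCore` of the assembly `stub_rankAsm2`, `rk :=` the completion rank), PROVED
here from `stub_rankCore2` and the landed operator semantics `stub_opSem` (p133301) by instantiating `a i j := coeff(x_i x_j)`,
`l i :=` linear + square coefficient and `μ :=` the fibre sums; `r ≤ sInf` gives `r ≤ rank` of every filling. -/
theorem rankCoreW2 :
    ∀ p q : ℕ, p.Prime → q.Prime → p ≠ q → 2 < p → 2 < q → ∀ R₀ : ℕ, ∀ δ : ℝ, 0 < δ → ∃ s r : ℕ, ∀ s' : ℕ, s ≤ s' →
      ∀ (n N : ℕ) (P : MvPolynomial (Fin n) (ZMod 2)), N ≤ n → (∀ c : ℕ, (Matrix.of fun (i j : Fin n) => if (i : ℕ) < c ∧ c ≤ (j : ℕ) then MvPolynomial.coeff (Finsupp.single i 1 + Finsupp.single j 1) P else 0).rank < R₀) →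
      (∃ B : Finset ℕ, (∀ b ∈ B, b < N) ∧ (∀ b ∈ B, ∀ b' ∈ B, b < b' → s' < b' - b) ∧ r ≤ sInf {k : ℕ | ∃ Q : Matrix (Fin n) (Fin n) (ZMod 2), (∀ i j : Fin n, Q i j ≠ 0 → ((i : ℕ) ∈ B ∧ (j : ℕ) < N ∧ 0 < Nat.dist (i : ℕ) (j : ℕ) ∧ Nat.dist (i : ℕ) (j : ℕ) ≤ s')) ∧ ((Matrix.of fun (i j : Fin n) => if (i : ℕ) ∈ B ∧ (j : ℕ) < N ∧ s' < Nat.dist (i : ℕ) (j : ℕ) then MvPolynomial.coeff (Finsupp.single i 1 + Finsupp.single j 1) P else 0) + Q).rank = k}) →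
      (∑ x ∈ Finset.range p ×ˢ Finset.range q, ∑ π : Fin n → ZMod 2, ∑ π' : Fin n → ZMod 2,
          |∑ T ∈ (Finset.range (2 ^ N)).filter (fun T => (p * T / 2 ^ N = x.1 ∧ q * T / 2 ^ N = x.2 ∧ (fun j : Fin n => if N ≤ (j : ℕ) then ∑ i ∈ Finset.range N, (if h : i < n then MvPolynomial.coeff (Finsupp.single (⟨i, h⟩ : Fin n) 1 + Finsupp.single j 1) P else 0) * (if Nat.testBit (p * T) i then (1 : ZMod 2) else 0) else 0) = π ∧ (fun j : Fin n => if N ≤ (j : ℕ) then ∑ i ∈ Finset.range N, (if h : i < n then MvPolynomial.coeff (Finsupp.single (⟨i, h⟩ : Fin n) 1 + Finsupp.single j 1) P else 0) * (if Nat.testBit (q * T) i then (1 : ZMod 2) else 0) else 0) = π')),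
            (if (((∑ i ∈ Finset.range N, ∑ j ∈ Finset.range N, (if i < j then (if h : i < n ∧ j < n then MvPolynomial.coeff (Finsupp.single (⟨i, h.1⟩ : Fin n) 1 + Finsupp.single (⟨j, h.2⟩ : Fin n) 1) P else 0) * (if Nat.testBit (p * T) i then (1 : ZMod 2) else 0) * (if Nat.testBit (p * T) j then (1 : ZMod 2) else 0) else 0)) + ∑ i ∈ Finset.range N, (if h : i < n then MvPolynomial.coeff (Finsupp.single (⟨i, h⟩ : Fin n) 1) P + MvPolynomial.coeff (Finsupp.single (⟨i, h⟩ : Fin n) 2) P else 0) * (if Nat.testBit (p * T) i then (1 : ZMod 2) else 0)) + ((∑ i ∈ Finset.range N, ∑ j ∈ Finset.range N, (if i < j then (if h : i < n ∧ j < n then MvPolynomial.coeff (Finsupp.single (⟨i, h.1⟩ : Fin n) 1 + Finsupp.single (⟨j, h.2⟩ : Fin n) 1) P else 0) * (if Nat.testBit (q * T) i then (1 : ZMod 2) else 0) * (if Nat.testBit (q * T) j then (1 : ZMod 2) else 0) else 0)) + ∑ i ∈ Finset.range N, (if h : i < n then MvPolynomial.coeff (Finsupp.single (⟨i, h⟩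 : Fin n) 1) P + MvPolynomial.coeff (Finsupp.single (⟨i, h⟩ : Fin n) 2) P else 0) * (if Nat.testBit (q * T) i then (1 : ZMod 2) else 0))) = 1 then (-1 : ℝ) else 1)|) ≤ δ * (2 : ℝ) ^ N := by
  intro p q hp hq hne h2p h2q R₀ δ hδ
  obtain ⟨s, r, hsr⟩ := stub_rankCore2 p q hp hq hne h2p h2q R₀ δ hδ
  refine ⟨s, r, fun s' hs' n N P hN hcut hB => ?_⟩
  have hsg := hsr s' hs'
  have hp0 : 0 < p := hp.pos
  have hq0 : 0 < q := hq.pos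
  have hp0 : 0 < p := hp.pos
  have hq0 : 0 < q := hq.pos
  have hSem := stub_opSem p q n P (fun M x π π' => (∑ T ∈ (Finset.range (2 ^ M)).filter (fun T => (p * T / 2 ^ M = x.1 ∧ q * T / 2 ^ M = x.2 ∧ (fun j : Fin n => if M ≤ (j : ℕ) then ∑ i ∈ Finset.range M, (if h : i < n then MvPolynomial.coeff (Finsupp.single (⟨i, h⟩ : Fin n) 1 + Finsupp.single j 1) P else 0) * (if Nat.testBit (p * T) i then (1 : ZMod 2) else 0) else 0) = π ∧ (fun j : Fin n => if M ≤ (j : ℕ) then ∑ i ∈ Finset.range M, (if h : i < n then MvPolynomial.coeff (Finsupp.single (⟨i, h⟩ : Fin n) 1 + Finsupp.single j 1) P else 0) * (if Nat.testBit (q * T) i then (1 : ZMod 2) else 0) else 0) = π')), (if (((∑ i ∈ Finset.range M, ∑ j ∈ Finset.range M, (if i < j then (if h : i < n ∧ j < n then MvPolynomial.coeff (Finsupp.single (⟨i, h.1⟩ : Fin n) 1 + Finsupp.single (⟨j, h.2⟩ : Fin n) 1) P else 0) * (if Nat.testBit (p * T) i then (1 : ZMod 2) else 0) * (if Nat.testBit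 (p * T) j then (1 : ZMod 2) else 0) else 0)) + ∑ i ∈ Finset.range M, (if h : i < n then MvPolynomial.coeff (Finsupp.single (⟨i, h⟩ : Fin n) 1) P + MvPolynomial.coeff (Finsupp.single (⟨i, h⟩ : Fin n) 2) P else 0) * (if Nat.testBit (p * T) i then (1 : ZMod 2) else 0)) + ((∑ i ∈ Finset.range M, ∑ j ∈ Finset.range M, (if i < j then (if h : i < n ∧ j < n then MvPolynomial.coeff (Finsupp.single (⟨i, h.1⟩ : Fin n) 1 + Finsupp.single (⟨j, h.2⟩ : Fin n) 1) P else 0) * (if Nat.testBit (q * T) i then (1 : ZMod 2) else 0) * (if Nat.testBit (q * T) j then (1 : ZMod 2) else 0) else 0)) + ∑ i ∈ Finset.range M, (if h : i < n then MvPolynomial.coeff (Finsupp.single (⟨i, h⟩ : Fin n) 1) P + MvPolynomial.coeff (Finsupp.single (⟨i, h⟩ : Fin n) 2) P else 0) * (if Nat.testBit (q * T) i then (1 : ZMod 2) else 0))) = 1 then (-1 : ℝ) else 1))) (fun _ _ _ _ => rfl) hp0 hq0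
  refine hsg n N (fun i j => (if h : i < n ∧ j < n then MvPolynomial.coeff (Finsupp.single (⟨i, h.1⟩ : Fin n) 1 + Finsupp.single (⟨j, h.2⟩ : Fin n) 1) P else 0)) (fun i => (if h : i < n then MvPolynomial.coeff (Finsupp.single (⟨i, h⟩ : Fin n) 1) P + MvPolynomial.coeff (Finsupp.single (⟨i, h⟩ : Fin n) 2) P else 0)) hN ?_ ?_
    (fun M x π π' => (∑ T ∈ (Finset.range (2 ^ M)).filter (fun T => (p * T / 2 ^ M = x.1 ∧ q * T / 2 ^ M = x.2 ∧ (fun j : Fin n => if M ≤ (j : ℕ) then ∑ i ∈ Finset.range M, (if h : i < n then MvPolynomial.coeff (Finsupp.single (⟨i, h⟩ : Fin n) 1 + Finsupp.single j 1) P else 0) * (if Nat.testBit (p * T) i then (1 : ZMod 2) else 0) else 0) = π ∧ (fun j : Fin n => if M ≤ (j : ℕ) then ∑ i ∈ Finset.range M, (if h : i < n then MvPolynomial.coeff (Finsupp.single (⟨i, h⟩ : Fin n) 1 + Finsupp.single j 1) P else 0) * (if Nat.testBit (q * T) i then (1 : ZMod 2) else 0) else 0) = π')), (if (((∑ i ∈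 Finset.range M, ∑ j ∈ Finset.range M, (if i < j then (if h : i < n ∧ j < n then MvPolynomial.coeff (Finsupp.single (⟨i, h.1⟩ : Fin n) 1 + Finsupp.single (⟨j, h.2⟩ : Fin n) 1) P else 0) * (if Nat.testBit (p * T) i then (1 : ZMod 2) else 0) * (if Nat.testBit (p * T) j then (1 : ZMod 2) else 0) else 0)) + ∑ i ∈ Finset.range M, (if h : i < n then MvPolynomial.coeff (Finsupp.single (⟨i, h⟩ : Fin n) 1) P + MvPolynomial.coeff (Finsupp.single (⟨i, h⟩ : Fin n) 2) P else 0) * (if Nat.testBit (p * T) i then (1 : ZMod 2) else 0)) + ((∑ i ∈ Finset.range M, ∑ j ∈ Finset.range M, (if i < j then (if h : i < n ∧ j < n then MvPolynomial.coeff (Finsupp.single (⟨i, h.1⟩ : Fin n) 1 + Finsupp.single (⟨j, h.2⟩ : Fin n) 1) P else 0) * (if Nat.testBit (q * T) i then (1 : ZMod 2) else 0) * (if Nat.testBit (q * T) j then (1 : ZMod 2) else 0) else 0)) + ∑ i ∈ Finset.range M, (if h : i < n then MvPolynomial.coeff (Finsupp.single (⟨i, h⟩ : Fin n) 1) P + MvPolynomial.coeff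 (Finsupp.single (⟨i, h⟩ : Fin n) 2) P else 0) * (if Nat.testBit (q * T) i then (1 : ZMod 2) else 0))) = 1 then (-1 : ℝ) else 1))) hSem.1 (fun N' hN' x' ρ ρ' => hSem.2 N' (by omega) x' ρ ρ')
  · -- digit cuts: the abstract pattern restricted to `Fin n` is the coefficient pattern
    intro c
    have hmat : (Matrix.of fun (i j : Fin n) => if (i : ℕ) < c ∧ c ≤ (j : ℕ) then
          (fun i j => (if h : i < n ∧ j < n then MvPolynomial.coeff (Finsupp.single (⟨i, h.1⟩ : Fin n) 1 + Finsupp.single (⟨j, h.2⟩ : Fin n) 1) P else 0)) (i : ℕ) (j : ℕ) else 0) =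
        (Matrix.of fun (i j : Fin n) => if (i : ℕ) < c ∧ c ≤ (j : ℕ) then
          MvPolynomial.coeff (Finsupp.single i 1 + Finsupp.single j 1) P else 0) := by
      ext i j
      simp only [Matrix.of_apply, dif_pos (show (i : ℕ) < n ∧ (j : ℕ) < n from ⟨i.isLt, j.isLt⟩), Fin.eta]
    rw [hmat]
    exact hcut c
  · -- the row set and its rank
    obtain ⟨B, hB1, hB2, hB3⟩ := hB
    refine ⟨B, hB1, hB2, ?_⟩
    have hmat : (Matrix.of fun (i j : Fin n) => if (i : ℕ) ∈ B ∧ (j : ℕ) < N ∧ s' < Nat.dist (i : ℕ) (j : ℕ) then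
          (if (i : ℕ) < (j : ℕ) then (fun i j => (if h : i < n ∧ j < n then MvPolynomial.coeff (Finsupp.single (⟨i, h.1⟩ : Fin n) 1 + Finsupp.single (⟨j, h.2⟩ : Fin n) 1) P else 0)) (i : ℕ) (j : ℕ)
            else (fun i j => (if h : i < n ∧ j < n then MvPolynomial.coeff (Finsupp.single (⟨i, h.1⟩ : Fin n) 1 + Finsupp.single (⟨j, h.2⟩ : Fin n) 1) P else 0)) (j : ℕ) (i : ℕ)) else 0) =
        (Matrix.of fun (i j : Fin n) => if (i : ℕ) ∈ B ∧ (j : ℕ) < N ∧ s' < Nat.dist (i : ℕ) (j : ℕ) then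
          MvPolynomial.coeff (Finsupp.single i 1 + Finsupp.single j 1) P else 0) := by
      ext i j
      simp only [Matrix.of_apply, dif_pos (show (i : ℕ) < n ∧ (j : ℕ) < n from ⟨i.isLt, j.isLt⟩),
        dif_pos (show (j : ℕ) < n ∧ (i : ℕ) < n from ⟨j.isLt, i.isLt⟩), Fin.eta]
      split_ifs with h1 h2
      · rfl
      · rw [add_comm]
      · rfl
    intro Q hQ
    have hmem : ((Matrix.of fun (i j : Fin n) => if (i : ℕ) ∈ B ∧ (j : ℕ) < N ∧ s' < Nat.dist (i : ℕ) (j : ℕ) then MvPolynomial.coeff (Finsupp.single i 1 + Finsupp.single j 1) P else 0) + Q).rank ∈ {k : ℕ | ∃ Q : Matrix (Fin n) (Fin n) (ZMod 2), (∀ i j : Fin n, Q i j ≠ 0 → ((i : ℕ) ∈ B ∧ (j : ℕ) < N ∧ 0 < Nat.dist (i : ℕ) (j : ℕ) ∧ Nat.dist (i : ℕ) (j : ℕ) ≤ s')) ∧ ((Matrix.of fun (i j : Fin n) => if (i : ℕ) ∈ B ∧ (j : ℕ) < N ∧ s' < Nat.dist (i : ℕ) (j : ℕ) then MvPolynomial.coeff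 (Finsupp.single i 1 + Finsupp.single j 1) P else 0) + Q).rank = k} := ⟨Q, hQ, rfl⟩
    rw [hmat]
    exact hB3.trans (Nat.sInf_le hmem)

/-- LOW-CUT KÁTAI (v41), from the rank core (`rankCoreW2` ⇐ `stub_rankCore2` ⇐ `stub_cellCore2` + the landed `stub_labelFourier` and
`stub_opSem`), the landed block semantics `stub_blockSum` (p131890) and the completion-rank structure lemmas `crank_dickson`,
`crank_split`, `crank_trunc`, `crank_le`, assembled by `stub_rankAsm2`. -/
theorem lowCutKatai :
    ∀ B : ℕ, ∀ τ : ℝ, 0 < τ → ∀ R₀ : ℕ, ∃ R s : ℕ, ∀ n : ℕ, ∀ P : MvPolynomial (Fin n) (ZMod 2), P.totalDegree ≤ 2 → (∀ c : ℕ, (Matrix.of fun (i j : Fin n) => if (i : ℕ) < c ∧ c ≤ (j : ℕ) then MvPolynomial.coeff (Finsupp.single i 1 + Finsupp.single j 1) P else 0).rank < R₀) → ¬ (∃ Q : MvPolynomial (Fin n) (ZMod 2), Q.totalDegree ≤ 2 ∧ (∀ m ∈ Q.support, ∀ i ∈ m.support, ∀ j ∈ m.support, Nat.dist i j ≤ s)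 ∧ ∃ k : ℕ, k < R ∧ ∃ u v : Fin k → Fin n → ZMod 2, ∀ x : Fin n → ZMod 2, MvPolynomial.eval x P = MvPolynomial.eval x Q + ∑ t : Fin k, (∑ i : Fin n, u t i * x i) * (∑ i : Fin n, v t i * x i)) → ∀ p q : ℕ, p.Prime → q.Prime → p ≠ q → 2 < p → 2 < q → p ≤ B → q ≤ B → ∀ M : ℕ, M ≤ 2 ^ n → 2 ^ n ≤ 2 * B * M → |∑ m ∈ Icc 1 M, (if MvPolynomial.eval (fun i : Fin n => if Nat.testBit (p * m) i then (1 : ZMod 2) else 0) P = 1 then (-1 : ℝ) else 1) * (if MvPolynomial.eval (fun i : Fin n => if Nat.testBit (q * m) i then (1 : ZMod 2) else 0) P = 1 then (-1 : ℝ) else 1)| ≤ τ * M := by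
  intro B τ hτ R₀
  exact stub_rankAsm2 (fun n P p m => (if MvPolynomial.eval (fun i : Fin n => if Nat.testBit (p * m) i then (1 : ZMod 2) else 0) P = 1 then (-1 : ℝ) else 1)) _ _ _
    (fun n (P : MvPolynomial (Fin n) (ZMod 2)) s B N => sInf {k : ℕ | ∃ Q : Matrix (Fin n) (Fin n) (ZMod 2), (∀ i j : Fin n, Q i j ≠ 0 → ((i : ℕ) ∈ B ∧ (j : ℕ) < N ∧ 0 < Nat.dist (i : ℕ) (j : ℕ) ∧ Nat.dist (i : ℕ) (j : ℕ) ≤ s)) ∧ ((Matrix.of fun (i j : Fin n) => if (i : ℕ) ∈ B ∧ (j : ℕ) < N ∧ s < Nat.dist (i : ℕ) (j : ℕ) then MvPolynomial.coeff (Finsupp.single i 1 + Finsupp.single j 1) P else 0) + Q).rank = k})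
    (fun n P p m => by
      show |(if _ then (-1 : ℝ) else 1)| ≤ 1
      split_ifs <;> simp)
    stub_blockSum rankCoreW2 crank_dickson crank_split crank_trunc crank_le B τ hτ R₀

/-- WORD DECAY for every pair of distinct odd primes (sorry-free): from the landed `stub_wordDecayOfUWC` (p117124),
`stub_uwcOfNoExact` (p117813), `stub_stationary` (p117599) and `stub_noExactTwistedCycle` (p121131). -/
theorem wordDecay_all :
    ∀ p q : ℕ, ∀ hp : p.Prime, ∀ hq : q.Prime, p ≠ q → 2 < p → 2 < q → (∀ δ : ℝ, 0 < δ → ∃ w : ℕ, ∀ word : List (Bool × Bool), w ≤ (word.filter (fun ab => ab ≠ (false, false))).length → ∑ y : Fin p × Fin q, |((word.map (fun ab : Bool × Bool => (Matrix.of fun (x y : Fin p × Fin q) => ∑ t ∈ ({0, 1} : Finset ℕ), if (y.1 : ℕ) = (p * t + x.1) / 2 ∧ (y.2 : ℕ) = (q * t + x.2) / 2 then (1 / 2 : ℝ) * (if ab.1 then (-1 : ℝ) ^ ((p * t + x.1) % 2) else 1) * (if ab.2 then (-1 : ℝ) ^ ((q * t + x.2) % 2) else 1) else 0))).prod) (⟨0,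 hp.pos⟩, ⟨0, hq.pos⟩) y| ≤ δ) :=
  fun p q hp hq hne h2p h2q =>
    stub_wordDecayOfUWC p q hp hq hne h2p h2q
      (stub_uwcOfNoExact p q hp hq hne h2p h2q (stub_stationary p q hp hq hne h2p h2q)
        (stub_noExactTwistedCycle p q hp hq hne h2p h2q))

/-- The crux `QuadraticDigitPhases` of route MobiusLadder, from the stubs of line `Sketch`. -/
theorem QuadraticDigitPhases_of : Summit.QuantumAdvantage.QuantumAdvantage.Theses.MobiusLadder.QuadraticDigitPhases := by
  exact quadraticDigitPhases_of_conjectures wordDecay_all lowCutKatai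

end Summit.QuantumAdvantage.QuantumAdvantage.Theorems.MobiusLadderQuadraticDigitPhases
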